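import Mathlib
import Summits.AtomisticToContinuum.HydrodynamicLimit.Theorems.ImplosionDichotomyDenseExcursionSonicCavityDefs
import Literature.Analysis.ODE.RepulsiveTransportSup

/-!
# The sonic window of the packing-order resolvent: the degenerate characteristic gains `1/Λ` with no loss
# (crux `DenseExcursion`, stmt-AtomisticToContinuum-12586, line `sonic-cavity-renewal` v7, stub `stub_packingResolvent`)

Helper file (`--supports stmt-AtomisticToContinuum-12586`) for the registered stub `stub_packingResolvent` (skeleton v7);
it proves the registered helper `packingResolvent_sonicWindow` — the SONIC-WINDOW piece of the Laplace gain of the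
packing-order resolvent, the piece that is specific to the REPULSIVE sonic point.

**Statement.** For a monatomic profile in the cavity tube, a differentiable real solution `(u₁, u₂)` of the real
resolvent system `Λu − Lu = f` (`L = (linW, linS)`), and a window `[−ρ, ρ]`, `0 < ρ ≤ 1`: if the forcing of the
degenerate characteristic field, `h = b₊₋ M + F₊` (`M = u₁ − 3u₂`, `F₊ = f₁ + 3f₂`, `b₊₋ = W′/3 + S′ + 2S`), is bounded by
`H` on the window, then the degenerate field `P = u₁ + 3u₂` satisfies `(Λ − 20)·|P| ≤ H` on the whole window — the sup
bound with the gain `1/(Λ − 20)` and NO loss of derivatives, for EVERY differentiable solution (no selection of a branch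
is needed: for `Λ > b₊₊` smoothness through the sonic point forces the bound).

**Mathematics.** `e₁ + 3e₂` of the two resolvent equations is the characteristic form
`c₊ P′ = (Λ − b₊₊) P − (b₊₋ M + F₊)` with `c₊ = W − 1 + S`, `b₊₊ = ⅔W′ + 2W − r + 2S′ + 4S` (`charP_eq`, pure algebra).
By the tube (a), `c₊(−ρ) > 0` and `c₊(ρ) < 0`: the characteristics LEAVE the window through both ends (repulsive sonic
point), so the generic two-sided-outflow maximum principle `Literature.Analysis.ODE.repulsive_transport_sup` (p156918:
at the maximum of `|P|`, Fermat resp. one-sided Fermat give `c₊PP′ ≤ 0`, whence `ν₀P² ≤ hP`) applies with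
`ν₀ = Λ − 20 ≤ Λ − b₊₊`; the bound `b₊₊ ≤ 20` on `[−1, 1]` is the tube envelope (c) (`|W| ≤ 1/4`, `|W′| ≤ 1/2`,
`S ≤ e^{−x} ≤ e`, `|S′| ≤ (5/4)e^{−x}` from `7/10 ≤ eˣS ≤ 1`, `|(eˣS)′| ≤ 1/4`), `bpp_le_twenty`. For `Λ ≤ 20` the
conclusion is trivial (`H ≥ 0`).

NOT here: the regular field `M` on the window (plain damped transport with inflow from the core,
`transport_sup_of_outflow_right`), the core, the centre, the far field.
-/

noncomputable section

open Filter Set Topology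

namespace Summit.AtomisticToContinuum.HydrodynamicLimit.Theorems.PackingAnalyticImplosion

open Summit.AtomisticToContinuum.HydrodynamicLimit.Theorems.R2OneModeTwoConditions
open Summit.AtomisticToContinuum.HydrodynamicLimit.Theorems.SonicCavityRenewal

/-- **THE DEGENERATE CHARACTERISTIC EQUATION WITH SOURCE** (pure algebra, `e₁ + 3e₂`): the real resolvent equations at a
point give `c₊ P′ = (Λ − b₊₊)P − (b₊₋M + F₊)` for `P = u₁ + 3u₂`, `M = u₁ − 3u₂`, `c₊ = a − 1 + b`,
`b₊₊ = ⅔a′ + 2a − r + 2b′ + 4b`, `b₊₋ = a′/3 + b′ + 2b`, `F₊ = F₁ + 3F₂`. [folklore] -/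
theorem charP_eq (Λ r a a' b b' U₁ U₁' U₂ U₂' F₁ F₂ : ℝ)
    (e1 : Λ * U₁ - ((a - 1) * U₁' + 3 * b * U₂' + (a' + 2 * a - r) * U₁ + (3 * b' + 6 * b) * U₂) = F₁)
    (e2 : Λ * U₂ - (b / 3 * U₁' + (a - 1) * U₂' + (b' + 2 * b) * U₁ + (a' / 3 + 2 * a - r) * U₂) = F₂) :
    (a - 1 + b) * (U₁' + 3 * U₂') = (Λ - (2 / 3 * a' + 2 * a - r + 2 * b' + 4 * b)) * (U₁ + 3 * U₂) -
      ((a' / 3 + b' + 2 * b) * (U₁ - 3 * U₂) + (F₁ + 3 * F₂)) := by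
  linear_combination (-1 : ℝ) * e1 - 3 * e2

/-- **THE ORDER-ZERO COEFFICIENT IS AT MOST `20` ON `[−1, 1]`**: `b₊₊ = ⅔W′ + 2W − r + 2S′ + 4S ≤ 20` from the tube
envelope (c) (`|W| ≤ 1/4`, `|W′| ≤ 1/2`, `eˣS ≤ 1`, `|(eˣS)′| ≤ 1/4`, whence `S ≤ e^{−x}`, `eˣS′ ≤ 5/4`) and
`e^{−x} ≤ e < 2.72`, `r > 1`. [folklore] -/
theorem bpp_le_twenty {r : ℝ} {W S : ℝ → ℝ} (hP : IsMonatomicProfile r W S) (hT : CavityTube r W S) {x : ℝ}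
    (hx1 : -1 ≤ x) (hx2 : x ≤ 1) : 2 / 3 * deriv W x + 2 * W x - r + 2 * deriv S x + 4 * S x ≤ 20 := by
  obtain ⟨hr1, -, -, hSs, hSpos, -⟩ := hP
  obtain ⟨-, -, -, -, -, -, -, hcW, hcS, -, -⟩ := hT
  obtain ⟨hW, hW', -⟩ := hcW x hx2
  obtain ⟨h7, h1, hs', -⟩ := hcS x hx2
  have hSd : DifferentiableAt ℝ S x := (hSs.differentiable (by simp)) x
  have hprod : deriv (fun y => Real.exp y * S y) x = Real.exp x * S x + Real.exp x * deriv S x := by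
    have h : HasDerivAt (fun y => Real.exp y * S y) (Real.exp x * S x + Real.exp x * deriv S x) x :=
      (Real.hasDerivAt_exp x).mul hSd.hasDerivAt
    exact h.deriv
  rw [hprod] at hs'
  have hex : Real.exp (-1) ≤ Real.exp x := Real.exp_le_exp.2 hx1
  have he : Real.exp x * Real.exp (-x) = 1 := by rw [← Real.exp_add]; simp
  have he1 : Real.exp (-x) ≤ Real.exp 1 := Real.exp_le_exp.2 (by linarith)
  have hE : Real.exp 1 < 2.7182818286 := Real.exp_one_lt_d9
  have hpos : 0 < Real.exp x := Real.exp_pos x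
  have hnpos : 0 < Real.exp (-x) := Real.exp_pos (-x)
  -- `S ≤ e^{-x} ≤ e` and `|S'| ≤ (5/4) e^{-x}`
  have hS : S x ≤ Real.exp (-x) := by nlinarith
  have hS' : deriv S x ≤ 5 / 4 * Real.exp (-x) := by
    have h2 : Real.exp x * deriv S x ≤ 5 / 4 := by
      have := (abs_le.1 hs').2; nlinarith [hSpos x]
    nlinarith
  have hWa := (abs_le.1 hW).2
  have hWa' := (abs_le.1 hW').2
  nlinarith

/-- **Helper `packingResolvent_sonicWindow` of `stub_packingResolvent`: THE DEGENERATE CHARACTERISTIC FIELD GAINS `1/Λ`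
ACROSS THE REPULSIVE SONIC POINT WITH NO LOSS.** For a monatomic profile in the cavity tube, a differentiable real solution
of the real resolvent system and a window `[−ρ, ρ] ⊆ [−1, 1]`: if `|b₊₋M + F₊| ≤ H` on the window then
`(Λ − 20)·|u₁ + 3u₂| ≤ H` on the window (`charP_eq` + tube (a): two-sided outflow + `repulsive_transport_sup` with
`ν₀ = Λ − 20 ≤ Λ − b₊₊` by `bpp_le_twenty`; trivial for `Λ ≤ 20`). [folklore] -/
theorem packingResolvent_sonicWindow : ∀ (r Λ ρ H : ℝ) (W S u₁ u₂ f₁ f₂ : ℝ → ℝ), IsMonatomicProfile r W S → CavityTube r W S → 0 < ρ → ρ ≤ 1 → Differentiable ℝ u₁ → Differentiable ℝ u₂ → (∀ x, Λ * u₁ x - ((W x - 1) * deriv u₁ x + 3 * S x * deriv u₂ x + (deriv W x + 2 * W x - r) * u₁ x + (3 * deriv S x + 6 * S x) * u₂ x) = f₁ x ∧ Λ * u₂ x - (S x / 3 * deriv u₁ x + (W x - 1) * deriv u₂ x + (deriv S x + 2 * S x) * u₁ x + (deriv W x / 3 + 2 * W x - r) * u₂ x) = f₂ x) → (∀ x ∈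 Set.Icc (-ρ) ρ, |(deriv W x / 3 + deriv S x + 2 * S x) * (u₁ x - 3 * u₂ x) + (f₁ x + 3 * f₂ x)| ≤ H) → ∀ x ∈ Set.Icc (-ρ) ρ, (Λ - 20) * |u₁ x + 3 * u₂ x| ≤ H := by
  intro r Λ ρ H W S u₁ u₂ f₁ f₂ hP hT hρ hρ1 hu₁ hu₂ heq hH x hx
  have hH0 : 0 ≤ H := le_trans (abs_nonneg _) (hH x hx)
  rcases le_or_gt Λ 20 with hΛ | hΛ
  · exact le_trans (mul_nonpos_of_nonpos_of_nonneg (by linarith) (abs_nonneg _)) hH0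
  have hsuper := hT.2.1
  have hsub := hT.2.2.1
  refine Literature.Analysis.ODE.repulsive_transport_sup (x₁ := -ρ) (x₂ := ρ) (ν₀ := Λ - 20) (H := H)
    (c := fun x => W x - 1 + S x) (β := fun x => Λ - (2 / 3 * deriv W x + 2 * W x - r + 2 * deriv S x + 4 * S x))
    (h := fun x => (deriv W x / 3 + deriv S x + 2 * S x) * (u₁ x - 3 * u₂ x) + (f₁ x + 3 * f₂ x))
    (P := fun x => u₁ x + 3 * u₂ x) (P' := fun x => deriv u₁ x + 3 * deriv u₂ x)
    (by linarith) (by linarith) (fun y _ => ?_) (fun y _ => ?_) (fun y hy => ?_) hH ?_ ?_ x hx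
  · exact (((hu₁ y).hasDerivAt).add (((hu₂ y).hasDerivAt).const_mul 3)).hasDerivWithinAt
  · exact charP_eq Λ r (W y) (deriv W y) (S y) (deriv S y) (u₁ y) (deriv u₁ y) (u₂ y) (deriv u₂ y) (f₁ y) (f₂ y)
      (heq y).1 (heq y).2
  · have := bpp_le_twenty hP hT (x := y) (by linarith [hy.1]) (by linarith [hy.2])
    show Λ - 20 ≤ Λ - (2 / 3 * deriv W y + 2 * W y - r + 2 * deriv S y + 4 * S y)
    linarith
  · show 0 ≤ W (-ρ) - 1 + S (-ρ)
    have := hsuper (-ρ) (by linarith); linarith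
  · show W ρ - 1 + S ρ ≤ 0
    have := hsub ρ hρ; linarith

end Summit.AtomisticToContinuum.HydrodynamicLimit.Theorems.PackingAnalyticImplosion

end
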